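import Summits.BirchSwinnertonDyer.Rank1Residual.Additive.X3CertificateDisplayKitEuler
import HarnessLib

/-!
# X3 certificate road at `p = 3` — display kit III: VALUE-TABLE variants of the kit-II lemmas for line
# characters assembled with `changeLevel` (`χ₄·(·/q)` for `q ≡ 3 (mod 4)`, products of Legendre symbols
# for composite kernel discriminants), which `decide` cannot evaluate through `MulChar.ofUnitHom`
# (cell `bsd-eis`, seat `bsd-eis-x3` gen 5; THEOREMS ONLY, nothing booked)

HONEST FRAMING (FULL-BSD rank-`≤ 1` programme D-0033, `run/shared/lean/pub/bsd-eis/README.md` §4):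
plumbing for the generated per-pair displays; nothing curve-specific, nothing booked. A separate module
(rather than an append to kit II) so that the ≈ 700 displays importing kit II are not rebuilt.

* `characterLValueC_three_eq_ratCast_table'` — kit II's `C`-side value table with `φ(a)` replaced by a
  supplied table `F a` (`hF : φ(a) = F a`);
* `quotCharacter_three_apply_natCast_of_table` — the value table of `ψ = ω₃·φ⁻¹` through `F`.

References: [GreenbergVatsal2000] §2 p. 28, §3 pp. 41–42; [LangCyclotomic1990] Ch. 2 §2 (B 7), Ch. 4 §3 Thm. 3.2.
-/

set_option autoImplicit false

noncomputable section

open scoped Classical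

open Finset NumberField IsDedekindDomain Polynomial
  Literature.NumberTheory.EllipticCurves
  Literature.NumberTheory.EllipticCurves.GreenbergVatsal2000

namespace Summit.BirchSwinnertonDyer.Rank1Residual.Additive.X3CertificateDisplayKit

section Tables

variable {m : ℕ} (φ : DirichletCharacter (ZMod 3) m) (S₀ : Finset (HeightOneSpectrum (𝓞 ℚ)))

/-- **`C`-side VALUE TABLE through a value table `F` of `φ`** (`hF : φ(a) = F a` on `ℕ`; `k ≥ 1`,
`k ≤ 16`, `m ≥ 1`): as `characterLValueC_three_eq_ratCast_table` with every `φ(a)` replaced by `F a`, so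
that `decide` evaluates it for characters assembled with `changeLevel` (whose `MulChar.ofUnitHom` is not
kernel-reducible). [cite: GreenbergVatsal2000, §3 pp. 41–42 ((26) and the Σ₀-Euler factors)] [cite: LangCyclotomic1990, Ch. 2 §2 (B 7), Ch. 4 §3 Thm. 3.2] -/
theorem characterLValueC_three_eq_ratCast_table' (PF : (ℕ → ℚ) → ℚ)
    (hS : ∀ f : ℕ → ℚ, ∏ v ∈ S₀, f (Rat.HeightOneSpectrum.natGenerator v) = PF f)
    (F : ℕ → ZMod 3) (hF : ∀ a : ℕ, φ (a : ZMod m) = F a)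
    (hm : 0 < m) {k : ℕ} (hk : 1 ≤ k) (hk' : k ≤ 16) :
    characterLValueC 3 φ S₀ k =
      ((PF (fun ℓ ↦ 1 - ((if 3 ∣ ℓ then 0 else
              (if F ℓ * ((ℓ : ZMod 3)⁻¹) ^ k = 0 then 0
                else if F ℓ * ((ℓ : ZMod 3)⁻¹) ^ k = 1 then 1 else -1) : ℤ) : ℚ) *
            (ℓ : ℚ) ^ (k - 1)) *
        (-(1 / (k : ℚ)) * (((m * 3 : ℕ) : ℚ) ^ (k - 1) *
          ∑ a ∈ Finset.range (m * 3),
            ((if 3 ∣ a then 0 else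
              (if F a * ((a : ZMod 3)⁻¹) ^ k = 0 then 0
                else if F a * ((a : ZMod 3)⁻¹) ^ k = 1 then 1 else -1) : ℤ) : ℚ) *
              ∑ i ∈ Finset.range (k + 1),
                (fun i : ℕ ↦ (if i = 0 then 1 else if i = 1 then -1 / 2 else if i = 2 then 1 / 6
                  else if i = 4 then -1 / 30 else if i = 6 then 1 / 42 else if i = 8 then -1 / 30
                  else if i = 10 then 5 / 66 else if i = 12 then -691 / 2730 else if i = 14 then 7 / 6
                  else if i = 16 then -3617 / 510 else 0 : ℚ)) i * (k.choose i : ℚ) *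
                  ((a : ℚ) / ((m * 3 : ℕ) : ℚ)) ^ (k - i))) : ℚ) : ℚ_[3]) := by
  rw [characterLValueC_three_eq_ratCast_table φ S₀ PF hS hm hk hk']
  simp only [hF]

/-- **Value table of the quotient character `ψ = ω₃·φ⁻¹` (level `3m`) through a value table `F` of
`φ`**: `ψ(a) = (a mod 3)·(F a)⁻¹` for `a` coprime to `3m`, else `0`
(`quotCharacter_three_apply_natCast` with `hF`). [cite: GreenbergVatsal2000, §2 p. 28 (φψ = ω)] -/
theorem quotCharacter_three_apply_natCast_of_table (F : ℕ → ZMod 3) (hF : ∀ a : ℕ, φ (a : ZMod m) = F a)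
    (a : ℕ) :
    (DirichletCharacter.changeLevel (dvd_mul_right 3 m) (MulChar.ofUnitHom (MonoidHom.id (ZMod 3)ˣ)) *
        DirichletCharacter.changeLevel (dvd_mul_left m 3) φ⁻¹ : DirichletCharacter (ZMod 3) (3 * m))
      (a : ZMod (3 * m)) =
      if a.Coprime (3 * m) then (a : ZMod 3) * (F a)⁻¹ else 0 := by
  rw [quotCharacter_three_apply_natCast φ a, hF]

end Tables

end Summit.BirchSwinnertonDyer.Rank1Residual.Additive.X3CertificateDisplayKit

end
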